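import Mathlib
import HarnessLib
import Literature.NumberTheory.Transcendental.LindemannWeierstrassProofs
import Summits.Schanuel.Schanuel.Theses.DiophantineDichotomy
import Summits.Schanuel.Schanuel.Theorems.DiophantineDichotomyApproximationRace
import Summits.Schanuel.Schanuel.Theorems.DiophantineDichotomyEPiRace

/-!
# Route `DiophantineDichotomy` — the eventual `n = 2` race `EPiRaceEv` (stmt-Schanuel-14976)

`Summit.Schanuel.Schanuel.Theses.DiophantineDichotomy.EPiRaceEv` is the support item of route
`DiophantineDichotomy` racing, at the point `θ = (π, e) ∈ ℂ²`, the level-1 approximation property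
(hypothesis: for `trdeg_ℚ ℚ(π, e) ≤ 1` there is `c ≥ 1` such that for all `Y ≥ Δ ≥ c` some
algebraic `γ ∈ ℂ²` with `[ℚ(γ):ℚ] ≤ d ≤ cΔ`, coordinates roots of non-zero integer polynomials of
degree `≤ d` and height `≤ H`, `log H ≤ cY`, satisfies `‖γ − θ‖ ≤ exp(−(Δ log H + dY)/c)`) against
the EVENTUAL simultaneous approximation measure `EPiSimultaneousTypeEv`
(`‖γ − θ‖ ≥ exp(−C(dᵃ log H + dᵇ))` with `a < 1`, but only for heights `H ≥ H₀(d)`), to conclude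
that `e` and `π` are algebraically independent over `ℚ`.

Proof ("race compactness" at `t = 1`, as in the item text). Suppose `![e, π]` is NOT algebraically
independent over `ℚ`. Then `trdeg_ℚ ℚ(π, e) ≤ 1`
(`EPiRace.trdeg_le_one_of_not_algebraicIndependent`, landed with the all-heights race `EPiRace`), so
the approximation property supplies `c`. FIX one scale `Δ ≥ c` with `cC(cΔ)^A ≤ Δ`
(`A = max a 0 < 1`) and let `Y → ∞` (`EPiRaceEv.race_eventually`: for every `Y ≥ Y₀` no `d ≤ cΔ`,
`H ≥ 1` satisfies `Δ log H + dY ≤ cC(dᵃ log H + dᵇ)`). The approximants `γ_Y` have bounded degree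
`d_Y ≤ D := ⌊cΔ⌋₊` and `‖γ_Y − θ‖ ≤ exp(−Y/c) → 0`. The set `S` of points of `ℂ²` all of whose
coordinates are roots of non-zero integer polynomials of degree `≤ D` and height
`≤ M := max_{d ≤ D} H₀(d)` is FINITE (`EPiRaceEv.finite_setOf_boundedRoots`, from Mathlib's
`Polynomial.bUnion_roots_finite`) and misses `θ` (`e = exp 1` is transcendental: Hermite–Lindemann,
`Literature.NumberTheory.Transcendental.transcendental_exp_holds`), hence a whole `ε`-ball around
`θ` misses `S`; for `Y ≥ Y₀` with `exp(−Y/c) < ε` the approximant `γ_Y` is therefore not in `S`,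
which forces `H_Y > M ≥ H₀(d_Y)`; now the eventual measure applies and gives
`Δ log H_Y + d_Y Y ≤ cC(d_Yᵃ log H_Y + d_Yᵇ)`, contradicting the race at `(Δ, Y)`.

No new definitions; inputs: the landed `ApproximationRace` / `EPiRace` helpers, Hermite–Lindemann
(proved in the tree) and Mathlib's finiteness of roots of bounded integer polynomials.
-/

-- `Summit.Schanuel.Schanuel.…` is the mandated summit/sub-problem namespace (single-conjunct summit), hence:
set_option linter.dupNamespace false

namespace Summit.Schanuel.Schanuel.Theorems

open Summit.Schanuel.Schanuel.Theses.DiophantineDichotomy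

/-! ## Elementary lemmas -/

/-- THE EVENTUAL RACE at level `t = 1` (pure real analysis): for `c ≥ 1`, `C > 0` and a degree
exponent `a < 1` there is ONE scale `Δ ≥ c` and a threshold `Y₀ ≥ Δ` such that at every
`Y ≥ Y₀` no `d ≥ 1`, `H ≥ 1` with `d ≤ cΔ` can satisfy `Δ·log H + d·Y ≤ cC(dᵃ log H + dᵇ)`
(choose `Δ` with `cC(cΔ)^{max a 0} ≤ Δ`, then `Y₀ = max Δ (cC(cΔ)^{max b 0} + 1)`). [folklore] -/
theorem EPiRaceEv.race_eventually {c C a b : ℝ} (hc : 1 ≤ c) (hC : 0 < C) (ha : a < 1) :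
    ∃ Δ Y₀ : ℝ, c ≤ Δ ∧ Δ ≤ Y₀ ∧ ∀ Y : ℝ, Y₀ ≤ Y → ∀ d H : ℕ, 1 ≤ d → 1 ≤ H → (d : ℝ) ≤ c * Δ →
      c * (C * ((d : ℝ) ^ a * Real.log H + (d : ℝ) ^ b)) < Real.log H * Δ + d * Y := by
  set A : ℝ := max a 0 with hA
  set B : ℝ := max b 0 with hB
  have hA0 : 0 ≤ A := le_max_right _ _
  have hB0 : 0 ≤ B := le_max_right _ _
  have hA1 : A < 1 := max_lt ha one_pos
  set e : ℝ := 1 - A with he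
  have hepos : 0 < e := by rw [he]; linarith
  have hcpos : 0 < c := lt_of_lt_of_le one_pos hc
  set M : ℝ := c * C * c ^ A with hM
  -- choose `Δ ≥ c` with `Δ ^ e ≥ M`
  have hev : ∀ᶠ Δ in Filter.atTop, c ≤ Δ ∧ M ≤ Δ ^ e :=
    (Filter.eventually_ge_atTop c).and ((tendsto_rpow_atTop hepos).eventually_ge_atTop M)
  obtain ⟨Δ, hcΔ, hMΔ⟩ := hev.exists
  have hΔpos : 0 < Δ := lt_of_lt_of_le hcpos hcΔ
  have hcΔpos : 0 < c * Δ := mul_pos hcpos hΔpos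
  refine ⟨Δ, max Δ (c * C * (c * Δ) ^ B + 1), hcΔ, le_max_left _ _, fun Y hY d H hd hH hdle => ?_⟩
  have hd1 : (1 : ℝ) ≤ d := by exact_mod_cast hd
  have hd0 : (0 : ℝ) ≤ d := by positivity
  have hH1 : (1 : ℝ) ≤ H := by exact_mod_cast hH
  have hL : 0 ≤ Real.log H := Real.log_nonneg hH1
  have hcC : 0 ≤ c * C := by positivity
  -- monotonicity in the exponents (base `d ≥ 1`)
  have hda : (d : ℝ) ^ a ≤ (d : ℝ) ^ A := Real.rpow_le_rpow_of_exponent_le hd1 (le_max_left _ _)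
  have hdb : (d : ℝ) ^ b ≤ (d : ℝ) ^ B := Real.rpow_le_rpow_of_exponent_le hd1 (le_max_left _ _)
  -- `d ≤ cΔ` in the exponents `A`, `B`
  have hdA : (d : ℝ) ^ A ≤ (c * Δ) ^ A := Real.rpow_le_rpow hd0 hdle hA0
  have hdB : (d : ℝ) ^ B ≤ (c * Δ) ^ B := Real.rpow_le_rpow hd0 hdle hB0
  -- first term: `cC d^A ≤ Δ`
  have hI : c * C * (d : ℝ) ^ A ≤ Δ := by
    calc c * C * (d : ℝ) ^ A ≤ c * C * (c * Δ) ^ A := mul_le_mul_of_nonneg_left hdA hcC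
      _ = M * Δ ^ A := by rw [Real.mul_rpow hcpos.le hΔpos.le, hM]; ring
      _ ≤ Δ ^ e * Δ ^ A := mul_le_mul_of_nonneg_right hMΔ (Real.rpow_nonneg hΔpos.le _)
      _ = Δ := by rw [← Real.rpow_add hΔpos, he, sub_add_cancel, Real.rpow_one]
  have hI' : c * C * (d : ℝ) ^ A * Real.log H ≤ Δ * Real.log H :=
    mul_le_mul_of_nonneg_right hI hL
  -- second term: `cC d^B < Y₀ ≤ Y ≤ d Y`
  have hY0 : 0 ≤ Y := le_trans hΔpos.le ((le_max_left _ _).trans hY)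
  have hII : c * C * (d : ℝ) ^ B < (d : ℝ) * Y := by
    calc c * C * (d : ℝ) ^ B ≤ c * C * (c * Δ) ^ B := mul_le_mul_of_nonneg_left hdB hcC
      _ < c * C * (c * Δ) ^ B + 1 := lt_add_one _
      _ ≤ max Δ (c * C * (c * Δ) ^ B + 1) := le_max_right _ _
      _ ≤ Y := hY
      _ ≤ (d : ℝ) * Y := le_mul_of_one_le_left hY0 hd1
  -- assemble
  have h1 : c * C * ((d : ℝ) ^ a * Real.log H) ≤ c * C * ((d : ℝ) ^ A * Real.log H) :=
    mul_le_mul_of_nonneg_left (mul_le_mul_of_nonneg_right hda hL) hcC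
  have h2 : c * C * (d : ℝ) ^ b ≤ c * C * (d : ℝ) ^ B := mul_le_mul_of_nonneg_left hdb hcC
  have hexp : c * (C * ((d : ℝ) ^ a * Real.log H + (d : ℝ) ^ b)) =
      c * C * ((d : ℝ) ^ a * Real.log H) + c * C * (d : ℝ) ^ b := by ring
  rw [hexp]
  linarith [h1, h2, hI', hII]

/-- Northcott-type finiteness in its most naive form: the points of `ℂ^ι` (`ι` finite) all of whose
coordinates are roots of non-zero integer polynomials of degree `≤ D` and naive height `≤ M` form a
finite set (finitely many such polynomials, each with finitely many roots —
`Polynomial.bUnion_roots_finite`). [folklore] -/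
theorem EPiRaceEv.finite_setOf_boundedRoots (ι : Type) [Fintype ι] (D M : ℕ) :
    {γ : ι → ℂ | ∀ i, ∃ P : Polynomial ℤ, P ≠ 0 ∧ P.natDegree ≤ D ∧
      (∀ k, |P.coeff k| ≤ (M : ℤ)) ∧ Polynomial.aeval (γ i) P = 0}.Finite := by
  classical
  set R : Set ℂ := {z | ∃ P : Polynomial ℤ, P ≠ 0 ∧ P.natDegree ≤ D ∧
      (∀ k, |P.coeff k| ≤ (M : ℤ)) ∧ Polynomial.aeval z P = 0} with hR
  have hRfin : R.Finite := by
    refine (Polynomial.bUnion_roots_finite (algebraMap ℤ ℂ) D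
      (Set.finite_Icc (-(M : ℤ)) M)).subset ?_
    rintro z ⟨P, hP0, hPdeg, hPH, hPz⟩
    refine Set.mem_iUnion.mpr ⟨P, Set.mem_iUnion.mpr
      ⟨⟨hPdeg, fun i => Set.mem_Icc.mpr (abs_le.mp (hPH i))⟩, ?_⟩⟩
    rw [Finset.mem_coe, Multiset.mem_toFinset,
      Polynomial.mem_roots_map_of_injective (algebraMap ℤ ℂ).injective_int hP0,
      ← Polynomial.aeval_def]
    exact hPz
  refine (Set.Finite.pi fun _ : ι => hRfin).subset ?_
  intro γ hγ
  exact Set.mem_univ_pi.mpr fun i => hγ i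

/-- `e = exp 1 ∈ ℂ` is transcendental over `ℚ` (Hermite–Lindemann at `α = 1`, the tree's
`transcendental_exp_holds`). [folklore] -/
theorem EPiRaceEv.transcendental_exp_one : Transcendental ℚ ((Real.exp 1 : ℝ) : ℂ) := by
  rw [Complex.ofReal_exp, Complex.ofReal_one]
  exact Literature.NumberTheory.Transcendental.transcendental_exp_holds isAlgebraic_one one_ne_zero

/-! ## The item -/

/-- **`EPiRaceEv`** (route `DiophantineDichotomy`, support item stmt-Schanuel-14976): the level-1
approximation property at `θ = (π, e)` (under `trdeg_ℚ ℚ(π, e) ≤ 1`) and the EVENTUAL simultaneous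
approximation measure `EPiSimultaneousTypeEv` (degree exponent `a < 1`, heights `H ≥ H₀(d)`) imply
that `e` and `π` are algebraically independent over `ℚ` — race compactness at `t = 1`: if not,
`trdeg_ℚ ℚ(π, e) ≤ 1`; fix the scale `Δ` of `EPiRaceEv.race_eventually` and let `Y → ∞`; the
approximants have degree `≤ ⌊cΔ⌋₊` and distance `≤ exp(−Y/c) → 0` to `θ`, so (the exceptional set
of bounded degree and height being finite and missing `θ`, as `e` is transcendental) their heights
eventually exceed `max_{d ≤ ⌊cΔ⌋₊} H₀(d)`, the measure applies, and
`Δ log H + dY ≤ cC(dᵃ log H + dᵇ)` contradicts the race. [folklore] -/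
theorem ePiRaceEv_proof : EPiRaceEv := by
  intro hAP hAT
  by_contra hnot
  obtain ⟨c, hc1, hAP'⟩ := hAP (EPiRace.trdeg_le_one_of_not_algebraicIndependent hnot)
  obtain ⟨a, b, C, ha, hC, hAT'⟩ := hAT
  choose H₀ hH₀ using hAT'
  obtain ⟨Δ, Y₀, hcΔ, hΔY₀, hrace⟩ := EPiRaceEv.race_eventually (b := b) hc1 hC ha
  have hcpos : (0 : ℝ) < c := lt_of_lt_of_le one_pos hc1
  have hΔpos : 0 < Δ := lt_of_lt_of_le hcpos hcΔ
  set θ : Fin 2 → ℂ := ![(Real.pi : ℂ), (Real.exp 1 : ℂ)] with hθ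
  -- bounded degree `D` and the height threshold `M` past which the measure applies
  set D : ℕ := ⌊c * Δ⌋₊ with hD
  set M : ℕ := (Finset.range (D + 1)).sup H₀ with hM
  -- the finite exceptional set of bounded degree and height
  set S : Set (Fin 2 → ℂ) := {γ | ∀ i, ∃ P : Polynomial ℤ, P ≠ 0 ∧ P.natDegree ≤ D ∧
      (∀ k, |P.coeff k| ≤ (M : ℤ)) ∧ Polynomial.aeval (γ i) P = 0} with hS
  have hSfin : S.Finite := EPiRaceEv.finite_setOf_boundedRoots (Fin 2) D M
  have hθS : θ ∉ S := by
    intro hmem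
    obtain ⟨P, hP0, -, -, hPz⟩ := hmem 1
    have halg : IsAlgebraic ℚ (θ 1) :=
      (show IsAlgebraic ℤ (θ 1) from ⟨P, hP0, hPz⟩).extendScalars (algebraMap ℤ ℚ).injective_int
    have h1 : θ 1 = ((Real.exp 1 : ℝ) : ℂ) := by simp [hθ]
    rw [h1] at halg
    exact EPiRaceEv.transcendental_exp_one halg
  obtain ⟨ε, hε, hball⟩ := Metric.isOpen_iff.mp hSfin.isClosed.isOpen_compl θ hθS
  -- the scale `Y`: past the race threshold and with `exp (-Y/c) < ε`
  set Y : ℝ := max Y₀ (-(c * Real.log ε) + 1) with hY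
  have hY₀Y : Y₀ ≤ Y := le_max_left _ _
  have hY0 : 0 ≤ Y := hΔpos.le.trans (hΔY₀.trans hY₀Y)
  obtain ⟨γ, d, H, hfin, hpoly, hd, -, hdist⟩ := hAP' Δ Y hcΔ (hΔY₀.trans hY₀Y)
  obtain ⟨P, hP0, hPdeg, hPH, hPz⟩ := hpoly 0
  have h1d : 1 ≤ d := ApproximationRace.one_le_of_root hP0 hPdeg hPz
  have h1H : 1 ≤ H := ApproximationRace.one_le_height hP0 hPH
  have hd1 : (1 : ℝ) ≤ d := by exact_mod_cast h1d
  have hH1 : (1 : ℝ) ≤ H := by exact_mod_cast h1H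
  have hL : 0 ≤ Real.log H := Real.log_nonneg hH1
  -- `γ` lies in the `ε`-ball around `θ`, hence outside `S`
  have hγball : γ ∈ Metric.ball θ ε := by
    rw [Metric.mem_ball, dist_eq_norm]
    have hYc : -(Y / c) < Real.log ε := by
      have hY1 : -(c * Real.log ε) + 1 ≤ Y := le_max_right _ _
      rw [neg_lt, lt_div_iff₀ hcpos]
      linarith
    have hmono : -((Real.log H * Δ + d * Y) / c) ≤ -(Y / c) := by
      have h1 : (0 : ℝ) ≤ Real.log H * Δ := mul_nonneg hL hΔpos.le
      have h2 : Y ≤ (d : ℝ) * Y := le_mul_of_one_le_left hY0 hd1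
      have h3 : Y / c ≤ (Real.log H * Δ + d * Y) / c :=
        div_le_div_of_nonneg_right (by linarith) hcpos.le
      linarith
    calc ‖γ - θ‖ ≤ Real.exp (-((Real.log H * Δ + d * Y) / c)) := hdist
      _ ≤ Real.exp (-(Y / c)) := Real.exp_le_exp.mpr hmono
      _ < ε := (Real.lt_log_iff_exp_lt hε).mp hYc
  have hγS : γ ∉ S := hball hγball
  -- so the height exceeds `M ≥ H₀ d`
  have hdD : d ≤ D := Nat.le_floor hd
  have hMH : M < H := by
    by_contra hle
    rw [not_lt] at hle
    refine hγS fun i => ?_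
    obtain ⟨Q, hQ0, hQdeg, hQH, hQz⟩ := hpoly i
    exact ⟨Q, hQ0, hQdeg.trans hdD, fun k => (hQH k).trans (by exact_mod_cast hle), hQz⟩
  have hH₀d : H₀ d ≤ H := by
    have hdmem : d ∈ Finset.range (D + 1) := Finset.mem_range.mpr (Nat.lt_succ_of_le hdD)
    exact (Finset.le_sup (f := H₀) hdmem).trans hMH.le
  -- the eventual measure applies: sandwich and race
  have hlow := hH₀ d H γ hH₀d hfin hpoly
  have hsand := Real.exp_le_exp.mp (hlow.trans hdist)
  have hineq : Real.log H * Δ + d * Y ≤ c * (C * ((d : ℝ) ^ a * Real.log H + (d : ℝ) ^ b)) := by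
    have := neg_le_neg hsand
    rw [neg_neg, neg_neg, div_le_iff₀ hcpos] at this
    linarith
  exact absurd hineq (not_le.mpr (hrace Y hY₀Y d H h1d h1H hd))

end Summit.Schanuel.Schanuel.Theorems
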